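import Summits.AtomisticToContinuum.FouriersLaw.Theses.HonestZwanzig
import Summits.AtomisticToContinuum.FouriersLaw.Theorems.HonestZwanzigNetworkReductionPackage

/-!
# HonestZwanzig / OrthogonalOhm — stub B `FixedNLimits` (line `Sketch`, skeleton v4): the limit `s ↓ 0` at fixed `N`

Support file for crux item `stmt-AtomisticToContinuum-12693` (`HonestZwanzig.OrthogonalOhm`, sub-problem
`FouriersLaw`), line `Sketch`, registered stub `stub_fixedNLimits`.

At fixed `N`, under the route's Feshbach package (`FeshbachIdentities`, item stmt-12697, proved) every
Laplace-transformed correlation of admissible observables is right-continuous at `s = 0`,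
`lap_s(f,g) → lap_0(f,g) = ∫₀^∞ corr(f,g)` (dominated convergence: `|e^{-st} corr| ≤ |corr| ∈ L¹(0,∞)`), hence the
energy Gram matrix `G(s) → G(0)` entrywise; if `det G(0)` is a unit, `Matrix.inv` is continuous at `G(0)`
(`continuousAt_matrix_inv`), so `G(s)⁻¹ → G(0)⁻¹` and every Schur pairing converges:
`schur_s(f,g) → schur_0(f,g)`.  This isolates the fixed-`N` EXISTENCE half of every clause of the crux into the
single algebraic condition `IsUnit (det G(0))` (supplied by stub F `stub_G0PosDef`).

* `tendsto_lap_adm` — `lap_s(f,g) → lap_0(f,g)` as `s ↓ 0` for admissible `f, g`;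
* `tendsto_G` — `G(s) → G(0)` in the matrix topology;
* `tendsto_G_inv` — `G(s)⁻¹ → G(0)⁻¹` when `IsUnit (det G(0))`;
* `tendsto_schur_of_isUnit_det` — `schur_s(f,g) → schur_0(f,g)`;
* `stub_fixedNLimits` — the registered closed signature (gadgets inlined), from `FeshbachIdentities`.
-/

noncomputable section

open MeasureTheory Finset Real Set Filter Topology
open Literature.MathematicalPhysics.KineticTheory.HeatConduction

namespace Summit.AtomisticToContinuum.FouriersLaw.Theorems.HonestZwanzig

namespace OrthogonalOhmLine.FixedNLimits

open NetworkReduction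

section Canonical

variable {ω₂ lam β γ : ℝ} {N : ℕ} {T : ℝ}
  {Adm : (PhaseSpace N → ℝ) → Prop}
  {corr : (PhaseSpace N → ℝ) → (PhaseSpace N → ℝ) → ℝ → ℝ}
  {lap : ℝ → (PhaseSpace N → ℝ) → (PhaseSpace N → ℝ) → ℝ}
  {cov : (PhaseSpace N → ℝ) → (PhaseSpace N → ℝ) → ℝ}
  {e : Fin N → PhaseSpace N → ℝ}
  {G : ℝ → Matrix (Fin N) (Fin N) ℝ}
  {schur : ℝ → (PhaseSpace N → ℝ) → (PhaseSpace N → ℝ) → ℝ}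
  (hAdm : ∀ f, Adm f ↔ (Continuous f ∧ ∃ A : ℝ, ∀ z,
    |f z| ≤ A * Real.exp ((pinnedChain ω₂ lam β γ).hamiltonian N z / (8 * T))))
  (hlap : ∀ s f g, lap s f g = ∫ t in Set.Ioi (0 : ℝ), Real.exp (-(s * t)) * corr f g t)
  (he : ∀ x z, e x z = z.2 x ^ 2 / 2 + (pinnedChain ω₂ lam β γ).U (z.1 x) +
    ∑ j : Fin N, ((if j.val = x.val + 1 then (pinnedChain ω₂ lam β γ).V (z.1 j - z.1 x) / 2 else 0) +
      (if x.val = j.val + 1 then (pinnedChain ω₂ lam β γ).V (z.1 x - z.1 j) / 2 else 0)))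
  (hG : ∀ s x y, G s x y = lap s (e x) (e y))
  (hschur : ∀ s f g, schur s f g = lap s f g - ∑ x, ∑ y, lap s f (e x) * (G s)⁻¹ x y * lap s (e y) g)
  (hFI : ∀ f g : PhaseSpace N → ℝ, Adm f → Adm g →
    Integrable f ((pinnedChain ω₂ lam β γ).gibbsMeasure N T) ∧
    (∀ t : ℝ, 0 ≤ t → Integrable (fun z => f z *
      (∫ y, g y ∂((pinnedChain ω₂ lam β γ).transitionKernel N T T t.toNNReal z)))
      ((pinnedChain ω₂ lam β γ).gibbsMeasure N T)) ∧
    IntegrableOn (corr f g) (Set.Ioi 0) ∧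
    (∀ t : ℝ, 0 ≤ t → corr f g t = corr (fun z => g (z.1, -z.2)) (fun z => f (z.1, -z.2)) t) ∧
    (∀ s : ℝ, 0 < s → ∀ x : Fin N,
      s * lap s (e x) g - cov (e x) g =
        lap s (fun z => (pinnedChain ω₂ lam β γ).generator N T T (e x) (z.1, -z.2)) g ∧
      s * lap s f (e x) - cov f (e x) = lap s f ((pinnedChain ω₂ lam β γ).generator N T T (e x))))
  (hω : 0 < ω₂) (hl : 0 ≤ lam) (hβ : 0 ≤ β) (hT : 0 < T)

include hlap hFI in
/-- **`s ↓ 0` in the Laplace transform** for admissible observables: `lap_s(f,g) → lap_0(f,g)` as `s ↓ 0`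
(dominated convergence, `corr(f,g) ∈ L¹(0,∞)`; the limit is the route's gadget at `s = 0`, `e^{-0·t} = 1`). -/
theorem tendsto_lap_adm {f g : PhaseSpace N → ℝ} (hf : Adm f) (hg : Adm g) :
    Tendsto (fun s => lap s f g) (nhdsWithin (0 : ℝ) (Set.Ioi 0)) (nhds (lap 0 f g)) := by
  have hI : IntegrableOn (corr f g) (Set.Ioi 0) := (hFI f g hf hg).2.2.1
  have hfun : (fun s => lap s f g) = fun s => ∫ t in Set.Ioi (0 : ℝ), Real.exp (-(s * t)) * corr f g t :=
    funext fun s => hlap s f g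
  rw [hfun, hlap 0 f g]
  refine tendsto_integral_filter_of_dominated_convergence (fun t => ‖corr f g t‖) ?_ ?_ hI.norm ?_
  · exact Eventually.of_forall fun s =>
      ((by fun_prop : Continuous fun t : ℝ => Real.exp (-(s * t))).aestronglyMeasurable).mul
        hI.aestronglyMeasurable
  · filter_upwards [self_mem_nhdsWithin] with s hs
    filter_upwards [ae_restrict_mem measurableSet_Ioi] with t ht
    rw [norm_mul, Real.norm_eq_abs, abs_of_pos (Real.exp_pos _)]
    have h1 : Real.exp (-(s * t)) ≤ 1 := by
      rw [← Real.exp_zero]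
      exact Real.exp_le_exp.mpr (by nlinarith [mul_pos (show (0:ℝ) < s from hs) (show (0:ℝ) < t from ht)])
    calc Real.exp (-(s * t)) * ‖corr f g t‖ ≤ 1 * ‖corr f g t‖ :=
        mul_le_mul_of_nonneg_right h1 (norm_nonneg _)
      _ = ‖corr f g t‖ := one_mul _
  · refine Eventually.of_forall fun t => ?_
    have hc : Continuous fun s : ℝ => Real.exp (-(s * t)) * corr f g t := by fun_prop
    exact (hc.tendsto 0).mono_left (nhdsWithin_le_nhds (s := Set.Ioi (0 : ℝ)))

include hAdm hlap he hG hFI hω hl hβ hT in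
/-- **`G(s) → G(0)`** as `s ↓ 0`, in the (product) topology of matrices. -/
theorem tendsto_G : Tendsto G (nhdsWithin (0 : ℝ) (Set.Ioi 0)) (nhds (G 0)) := by
  refine tendsto_pi_nhds.2 fun x => tendsto_pi_nhds.2 fun y => ?_
  have h := tendsto_lap_adm hlap hFI (adm_e Adm hAdm e he hω hl hβ hT x) (adm_e Adm hAdm e he hω hl hβ hT y)
  have hfun : (fun s => G s x y) = fun s => lap s (e x) (e y) := funext fun s => hG s x y
  rw [hfun, hG 0 x y]
  exact h

include hAdm hlap he hG hFI hω hl hβ hT in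
/-- **`G(s)⁻¹ → G(0)⁻¹`** as `s ↓ 0` when `det G(0)` is a unit (continuity of `Matrix.inv` at an invertible
matrix: inverse of the determinant times the adjugate). -/
theorem tendsto_G_inv (hdet : IsUnit (G 0).det) :
    Tendsto (fun s => (G s)⁻¹) (nhdsWithin (0 : ℝ) (Set.Ioi 0)) (nhds (G 0)⁻¹) := by
  have hne : (G 0).det ≠ 0 := hdet.ne_zero
  have hRi : ContinuousAt Ring.inverse (G 0).det := by
    rw [Ring.inverse_eq_inv']
    exact continuousAt_inv₀ hne
  have hinv : ContinuousAt Inv.inv (G 0) := continuousAt_matrix_inv (G 0) hRi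
  exact hinv.tendsto.comp (tendsto_G hAdm hlap he hG hFI hω hl hβ hT)

include hAdm hlap he hG hFI hω hl hβ hT in
/-- Entrywise form of `tendsto_G_inv`. -/
theorem tendsto_G_inv_apply (hdet : IsUnit (G 0).det) (x y : Fin N) :
    Tendsto (fun s => (G s)⁻¹ x y) (nhdsWithin (0 : ℝ) (Set.Ioi 0)) (nhds ((G 0)⁻¹ x y)) := by
  have h := tendsto_G_inv hAdm hlap he hG hFI hω hl hβ hT hdet
  have hx : Tendsto (fun s => (G s)⁻¹ x) (nhdsWithin (0 : ℝ) (Set.Ioi 0)) (nhds ((G 0)⁻¹ x)) :=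
    tendsto_pi_nhds.1 h x
  exact tendsto_pi_nhds.1 hx y

include hAdm hlap he hG hschur hFI hω hl hβ hT in
/-- **The Schur pairing is right-continuous at `s = 0`** when `det G(0)` is a unit: for admissible `f, g`,
`schur_s(f,g) → schur_0(f,g)` as `s ↓ 0`. -/
theorem tendsto_schur_of_isUnit_det (hdet : IsUnit (G 0).det) {f g : PhaseSpace N → ℝ}
    (hf : Adm f) (hg : Adm g) :
    Tendsto (fun s => schur s f g) (nhdsWithin (0 : ℝ) (Set.Ioi 0)) (nhds (schur 0 f g)) := by
  have hfun : (fun s => schur s f g) =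
      fun s => lap s f g - ∑ x, ∑ y, lap s f (e x) * (G s)⁻¹ x y * lap s (e y) g :=
    funext fun s => hschur s f g
  rw [hfun, hschur 0 f g]
  refine (tendsto_lap_adm hlap hFI hf hg).sub (tendsto_finsetSum _ fun x _ => ?_)
  refine tendsto_finsetSum _ fun y _ => ?_
  exact ((tendsto_lap_adm hlap hFI hf (adm_e Adm hAdm e he hω hl hβ hT x)).mul
    (tendsto_G_inv_apply hAdm hlap he hG hFI hω hl hβ hT hdet x y)).mul
    (tendsto_lap_adm hlap hFI (adm_e Adm hAdm e he hω hl hβ hT y) hg)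

end Canonical

end OrthogonalOhmLine.FixedNLimits

open OrthogonalOhmLine.FixedNLimits in
/-- **Stub B** (`FixedNLimits`, line `Sketch`, skeleton v4 of crux `stmt-AtomisticToContinuum-12693`): under the
route's Feshbach package and invertibility of `G(0)`, every Schur pairing of admissible observables is continuous at
`s = 0` from the right: `schur_s(f,g) → schur_0(f,g)` as `s ↓ 0`. -/
theorem stub_fixedNLimits : Summit.AtomisticToContinuum.FouriersLaw.Theses.HonestZwanzig.FeshbachIdentities →
    ∀ ω₂ lam β γ : ℝ, 0 < ω₂ → 0 < lam → 0 < β → 0 < γ → ∀ T : ℝ, 0 < T → ∀ N : ℕ, 2 ≤ N → let P := Literature.MathematicalPhysics.KineticTheory.HeatConduction.pinnedChain ω₂ lam β γ; let X := Literature.MathematicalPhysics.KineticTheory.HeatConduction.PhaseSpace N; let μ : MeasureTheory.Measure X := P.gibbsMeasure N T; let corr : (X → ℝ) → (X → ℝ) → ℝ → ℝ := fun f g t => (∫ z, f z * (∫ y, g y ∂(P.transitionKernel N T T t.toNNReal z)) ∂μ) - (∫ z, f z ∂μ) * (∫ z, g z ∂μ); let lap : ℝ → (X → ℝ) → (X →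 ℝ) → ℝ := fun s f g => ∫ t in Set.Ioi (0 : ℝ), Real.exp (-(s * t)) * corr f g t; let e : Fin N → X → ℝ := fun x z => z.2 x ^ 2 / 2 + P.U (z.1 x) + ∑ j : Fin N, ((if j.val = x.val + 1 then P.V (z.1 j - z.1 x) / 2 else 0) + (if x.val = j.val + 1 then P.V (z.1 x - z.1 j) / 2 else 0)); let G : ℝ → Matrix (Fin N) (Fin N) ℝ := fun s => Matrix.of fun x y => lap s (e x) (e y); let schur : ℝ → (X → ℝ) → (X → ℝ) → ℝ := fun s f g => lap s f g - ∑ x : Fin N, ∑ y : Fin N, lap s f (e x) * (G s)⁻¹ x y * lap s (e y) g;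
      IsUnit (G 0).det → ∀ f g : X → ℝ,
        (Continuous f ∧ ∃ A : ℝ, ∀ z, |f z| ≤ A * Real.exp (P.hamiltonian N z / (8 * T))) →
        (Continuous g ∧ ∃ A : ℝ, ∀ z, |g z| ≤ A * Real.exp (P.hamiltonian N z / (8 * T))) →
        Filter.Tendsto (fun s => schur s f g) (nhdsWithin (0 : ℝ) (Set.Ioi 0)) (nhds (schur 0 f g)) := by
  intro hFI ω₂ lam β γ hω hl hβ hγ T hT N hN P X μ corr lap e G schur hdet f g hf hg
  obtain ⟨-, hFI2, -, -⟩ := hFI ω₂ lam β γ hω hl hβ hγ T hT N hN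
  exact tendsto_schur_of_isUnit_det (ω₂ := ω₂) (lam := lam) (β := β) (γ := γ) (N := N) (T := T)
    (Adm := fun f => Continuous f ∧ ∃ A : ℝ, ∀ z, |f z| ≤ A * Real.exp (P.hamiltonian N z / (8 * T)))
    (corr := corr) (lap := lap) (cov := fun f g => (∫ z, f z * g z ∂μ) - (∫ z, f z ∂μ) * (∫ z, g z ∂μ))
    (e := e) (G := G) (schur := schur)
    (fun f => Iff.rfl) (fun s f g => rfl) (fun x z => rfl) (fun s x y => rfl) (fun s f g => rfl) hFI2
    hω hl.le hβ.le hT hdet hf hg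

end Summit.AtomisticToContinuum.FouriersLaw.Theorems.HonestZwanzig
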